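import Mathlib.CategoryTheory.Equivalence
import Literature.AnabelianGeometry.SemiGraphs.OfProfiniteGroups

/-!
# [SemiAnbd] Remark 2.6.1: the graph of anabelioids `B(G) — B(H) — B(H)` — proofs, part 1

Mochizuki, *Semi-graphs of anabelioids*, Publ. RIMS **42** (2006) 221–322, §2, Remark 2.6.1,
author's manuscript p. 29 [cite: MochizukiSemiAnbd2006, Rem. 2.6.1 p.29].  Proof-only companion (no
definitions) of `OfProfiniteGroups.lean` (p406419) towards the named fact `remark_2_6_1`.  For the
path graph of groups `G — H — H` (`remark261Groups H`; vertices `0, 1, 2` in the Lean numbering):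

* the restriction `ρ₀ : B(𝒢) ⥤ B(G)` to the first vertex is an EQUIVALENCE of categories
  (`remark261_isEquivalence`): every gluing datum over the contractible path is trivial, since all
  the branch functors except the first are restrictions along `H = H`, i.e. identities;
* hence "the profinite fundamental group … is naturally isomorphic to `G`" in the typed form: the
  first conjunct of `remark_2_6_1`, `Π_0 → Π_𝒢` bijective (`remark261_piVToPi_bijective`), and the
  image of `Π_ℍ → Π_𝒢` for `ℍ = {0}` is everything (`remark261_range_piHToPi_H`);
* hence the second half of the second conjunct: the conclusion of Proposition 2.6 fails for the
  pair `(𝕂, ℍ)` (`remark261_not_prop26Conclusion_KH`).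

Deliberately NOT here (part 2): the pair `(ℍ, 𝕂)`, which amounts to the finiteness of the index of
the image of `Π_𝕂 ≅ π₁(B(H)) → Π_𝒢 ≅ π₁(B(G))`.
-/

namespace Literature.AnabelianGeometry.SemiGraphs

open CategoryTheory
open Literature.AlgebraicGeometry.Frobenioids (BCat)
open Literature.AnabelianGeometry.Anabelioids

/-! ### Whiskering along an equivalence is bijective on fundamental groups -/

universe v₁ v₂ u₁ u₂ w in
/-- If `P : Y ⥤ X` is an equivalence of categories, `π₁(P) : Aut F → Aut (P ⋙ F)` is bijective
([GeoAn] Def. 1.1.2 (i)/(ii): isomorphisms of anabelioids are equivalences and induce isomorphisms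
of fundamental groups). [cite: MochizukiGeoAn2004, Def. 1.1.2(i) p.10] -/
theorem pi1Map_bijective_of_isEquivalence {X : Type u₁} [Category.{v₁} X] {Y : Type u₂}
    [Category.{v₂} Y] (P : Y ⥤ X) [P.IsEquivalence] (F : X ⥤ FintypeCat.{w}) :
    Function.Bijective (pi1Map P F) := by
  let W := (Functor.whiskeringLeft Y X FintypeCat.{w}).obj P
  have hW : W.FullyFaithful := Functor.FullyFaithful.ofFullyFaithful W
  exact (hW.isoEquiv (X := F) (Y := F)).bijective

/-! ### The graph `B(G) — B(H) — B(H)`: `ρ₀` is an equivalence -/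

section Remark261

variable {G : Type} [Group G] [TopologicalSpace G] [IsTopologicalGroup G] (H : Subgroup G)

/-- `ρ₀ : B(𝒢) ⥤ B(G)` is essentially surjective: a `G`-set `S₀` extends to the object of `B(𝒢)` with
`S₀` at the first vertex, its restriction to `H` everywhere else, and identity gluings.
[cite: MochizukiSemiAnbd2006, Rem. 2.6.1 p.29] -/
theorem remark261_essSurj : ((remark261Groups H).toAnabelioids.ρ (0 : Fin 3)).EssSurj := by
  refine ⟨fun S₀ => ?_⟩
  let 𝒢 := (remark261Groups H).toAnabelioids
  let R : 𝒢.E (0 : Fin 2) := (𝒢.pull ((0 : Fin 2), false) (0 : Fin 3) rfl).pullback.obj S₀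
  let A : 𝒢.BObj :=
    { S := Fin.cases (motive := fun v => 𝒢.V v) S₀
        (fun i => Fin.cases (motive := fun i : Fin 2 => 𝒢.V i.succ) (show 𝒢.V (1 : Fin 3) from R)
          (fun j => Fin.cases (motive := fun j : Fin 1 => 𝒢.V j.succ.succ) (show 𝒢.V (2 : Fin 3) from R)
            (fun k => k.elim0) j) i)
      T := fun _ => R
      ψ := fun b v h => by
        obtain ⟨⟨e, he⟩, c⟩ := b
        have hv : _ = v := Option.some.inj h
        subst hv
        rcases e with _ | _ | e
        · cases c
          · exact Iso.refl _
          · exact Iso.refl _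
        · cases c
          · exact Iso.refl _
          · exact Iso.refl _
        · exact absurd he (by omega) }
  exact ⟨A, ⟨Iso.refl _⟩⟩

/-- `ρ₀ : B(𝒢) ⥤ B(G)` is full: a `G`-map of the first vertex objects propagates along the gluing
isomorphisms to a morphism of `B(𝒢)`. [cite: MochizukiSemiAnbd2006, Rem. 2.6.1 p.29] -/
theorem remark261_full : ((remark261Groups H).toAnabelioids.ρ (0 : Fin 3)).Full := by
  refine ⟨fun {A B} f => ?_⟩
  let 𝒢 := (remark261Groups H).toAnabelioids
  let R := (𝒢.pull ((0 : Fin 2), false) (0 : Fin 3) rfl).pullback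
  let fT0 :=
    (A.ψ ((0 : Fin 2), false) (0 : Fin 3) rfl).inv ≫ R.map f ≫ (B.ψ ((0 : Fin 2), false) (0 : Fin 3) rfl).hom
  let fS1 :=
    (A.ψ ((0 : Fin 2), true) (1 : Fin 3) rfl).hom ≫ fT0 ≫ (B.ψ ((0 : Fin 2), true) (1 : Fin 3) rfl).inv
  let fT1 :=
    (A.ψ ((1 : Fin 2), false) (1 : Fin 3) rfl).inv ≫ (𝒢.pull ((1 : Fin 2), false) (1 : Fin 3) rfl).pullback.map fS1 ≫
      (B.ψ ((1 : Fin 2), false) (1 : Fin 3) rfl).hom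
  let fS2 :=
    (A.ψ ((1 : Fin 2), true) (2 : Fin 3) rfl).hom ≫ fT1 ≫ (B.ψ ((1 : Fin 2), true) (2 : Fin 3) rfl).inv
  refine ⟨{ fS := Fin.cases (motive := fun v => A.S v ⟶ B.S v) f
              (fun i => Fin.cases (motive := fun i : Fin 2 => A.S i.succ ⟶ B.S i.succ) fS1
                (fun j => Fin.cases (motive := fun j : Fin 1 => A.S j.succ.succ ⟶ B.S j.succ.succ)
                  fS2 (fun k => k.elim0) j) i)
            fT := Fin.cases (motive := fun e => A.T e ⟶ B.T e) fT0
              (fun j => Fin.cases (motive := fun j : Fin 1 => A.T j.succ ⟶ B.T j.succ) fT1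
                (fun k => k.elim0) j)
            comm := ?_ }, rfl⟩
  rintro ⟨e, c⟩ v h
  have hv : (if c then e.succ else e.castSucc) = v := Option.some.inj h
  subst hv
  fin_cases e <;> fin_cases c
  · change ((A.ψ ((0 : Fin 2), true) (1 : Fin 3) rfl).hom ≫ fT0 ≫
        (B.ψ ((0 : Fin 2), true) (1 : Fin 3) rfl).inv) ≫ (B.ψ ((0 : Fin 2), true) (1 : Fin 3) rfl).hom =
      (A.ψ ((0 : Fin 2), true) (1 : Fin 3) rfl).hom ≫ fT0
    erw [Category.assoc, Category.assoc, Iso.inv_hom_id]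
    erw [Category.comp_id]
    rfl
  · change R.map f ≫ (B.ψ ((0 : Fin 2), false) (0 : Fin 3) rfl).hom =
      (A.ψ ((0 : Fin 2), false) (0 : Fin 3) rfl).hom ≫ ((A.ψ ((0 : Fin 2), false) (0 : Fin 3) rfl).inv ≫
        R.map f ≫ (B.ψ ((0 : Fin 2), false) (0 : Fin 3) rfl).hom)
    erw [Iso.hom_inv_id_assoc]
    rfl
  · change ((A.ψ ((1 : Fin 2), true) (2 : Fin 3) rfl).hom ≫ fT1 ≫
        (B.ψ ((1 : Fin 2), true) (2 : Fin 3) rfl).inv) ≫ (B.ψ ((1 : Fin 2), true) (2 : Fin 3) rfl).hom =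
      (A.ψ ((1 : Fin 2), true) (2 : Fin 3) rfl).hom ≫ fT1
    erw [Category.assoc, Category.assoc, Iso.inv_hom_id]
    erw [Category.comp_id]
    rfl
  · change (𝒢.pull ((1 : Fin 2), false) (1 : Fin 3) rfl).pullback.map fS1 ≫
        (B.ψ ((1 : Fin 2), false) (1 : Fin 3) rfl).hom =
      (A.ψ ((1 : Fin 2), false) (1 : Fin 3) rfl).hom ≫ ((A.ψ ((1 : Fin 2), false) (1 : Fin 3) rfl).inv ≫
        (𝒢.pull ((1 : Fin 2), false) (1 : Fin 3) rfl).pullback.map fS1 ≫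
          (B.ψ ((1 : Fin 2), false) (1 : Fin 3) rfl).hom)
    erw [Iso.hom_inv_id_assoc]
    rfl

/-- `ρ₀ : B(𝒢) ⥤ B(G)` is faithful: the gluing conditions determine a morphism of `B(𝒢)` from its
component at the first vertex. [cite: MochizukiSemiAnbd2006, Rem. 2.6.1 p.29] -/
theorem remark261_faithful : ((remark261Groups H).toAnabelioids.ρ (0 : Fin 3)).Faithful := by
  refine ⟨fun {A B} g g' hfg => ?_⟩
  let 𝒢 := (remark261Groups H).toAnabelioids
  have h0 : g.fS (0 : Fin 3) = g'.fS (0 : Fin 3) := hfg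
  have key0 : ∀ gg : A ⟶ B, gg.fT (0 : Fin 2) = (A.ψ ((0 : Fin 2), false) (0 : Fin 3) rfl).inv ≫
      (𝒢.pull ((0 : Fin 2), false) (0 : Fin 3) rfl).pullback.map (gg.fS (0 : Fin 3)) ≫
        (B.ψ ((0 : Fin 2), false) (0 : Fin 3) rfl).hom :=
    fun gg => ((Iso.inv_comp_eq _).mpr (gg.comm ((0 : Fin 2), false) (0 : Fin 3) rfl)).symm
  have hT0 : g.fT (0 : Fin 2) = g'.fT (0 : Fin 2) := by rw [key0 g, key0 g', h0]
  have key1 : ∀ gg : A ⟶ B, gg.fS (1 : Fin 3) = ((A.ψ ((0 : Fin 2), true) (1 : Fin 3) rfl).hom ≫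
      gg.fT (0 : Fin 2)) ≫ (B.ψ ((0 : Fin 2), true) (1 : Fin 3) rfl).inv :=
    fun gg => ((Iso.comp_inv_eq _).mpr (gg.comm ((0 : Fin 2), true) (1 : Fin 3) rfl).symm).symm
  have hS1 : g.fS (1 : Fin 3) = g'.fS (1 : Fin 3) := by rw [key1 g, key1 g', hT0]
  have key2 : ∀ gg : A ⟶ B, gg.fT (1 : Fin 2) = (A.ψ ((1 : Fin 2), false) (1 : Fin 3) rfl).inv ≫
      (𝒢.pull ((1 : Fin 2), false) (1 : Fin 3) rfl).pullback.map (gg.fS (1 : Fin 3)) ≫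
        (B.ψ ((1 : Fin 2), false) (1 : Fin 3) rfl).hom :=
    fun gg => ((Iso.inv_comp_eq _).mpr (gg.comm ((1 : Fin 2), false) (1 : Fin 3) rfl)).symm
  have hT1 : g.fT (1 : Fin 2) = g'.fT (1 : Fin 2) := by rw [key2 g, key2 g', hS1]
  have key3 : ∀ gg : A ⟶ B, gg.fS (2 : Fin 3) = ((A.ψ ((1 : Fin 2), true) (2 : Fin 3) rfl).hom ≫
      gg.fT (1 : Fin 2)) ≫ (B.ψ ((1 : Fin 2), true) (2 : Fin 3) rfl).inv :=
    fun gg => ((Iso.comp_inv_eq _).mpr (gg.comm ((1 : Fin 2), true) (2 : Fin 3) rfl).symm).symm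
  have hS2 : g.fS (2 : Fin 3) = g'.fS (2 : Fin 3) := by rw [key3 g, key3 g', hT1]
  apply SemiGraphOfAnabelioids.BObj.hom_ext
  · funext v
    obtain ⟨v, hv⟩ := v
    rcases v with _ | _ | _ | v
    · exact h0
    · exact hS1
    · exact hS2
    · exact absurd hv (by omega)
  · funext e
    obtain ⟨e, he⟩ := e
    rcases e with _ | _ | e
    · exact hT0
    · exact hT1
    · exact absurd he (by omega)

/-- **`ρ₀ : B(𝒢) ⥤ B(G)` is an equivalence of categories** for the path graph `G — H — H`
("profinite fundamental group … naturally isomorphic to `G`").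
[cite: MochizukiSemiAnbd2006, Rem. 2.6.1 p.29] -/
theorem remark261_isEquivalence :
    ((remark261Groups H).toAnabelioids.ρ (0 : Fin 3)).IsEquivalence :=
  { faithful := remark261_faithful H
    full := remark261_full H
    essSurj := remark261_essSurj H }

/-- **First conjunct of Remark 2.6.1** — DISCHARGED: `Π_0 → Π_𝒢` is bijective for every basepoint
of `B(G)` at the first vertex. [cite: MochizukiSemiAnbd2006, Rem. 2.6.1 p.29] -/
theorem remark261_piVToPi_bijective
    (F : (remark261Groups H).toAnabelioids.V (0 : Fin 3) ⥤ FintypeCat.{0}) :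
    Function.Bijective ((remark261Groups H).toAnabelioids.piVToPi (0 : Fin 3) F) := by
  haveI := remark261_isEquivalence H
  exact pi1Map_bijective_of_isEquivalence _ F

/-- The image of `Π_ℍ → Π_𝒢` for `ℍ` the first vertex is all of `Π_𝒢`.
[cite: MochizukiSemiAnbd2006, Rem. 2.6.1 p.29] -/
theorem remark261_range_piHToPi_H
    (F : (remark261Groups H).toAnabelioids.V (0 : Fin 3) ⥤ FintypeCat.{0}) :
    ((remark261Groups H).toAnabelioids.piHToPi remark261H ⟨(0 : Fin 3), rfl⟩ F).range = ⊤ := by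
  rw [MonoidHom.range_eq_top]
  intro γ
  obtain ⟨σ, rfl⟩ := (remark261_piVToPi_bijective H F).2 γ
  refine ⟨pi1Map (((remark261Groups H).toAnabelioids.restrict remark261H).ρ ⟨(0 : Fin 3), rfl⟩) F σ,
    ?_⟩
  ext
  rfl

/-- **Second conjunct of Remark 2.6.1, second half** — DISCHARGED: the conclusion of Proposition 2.6
fails for the pair `(𝕂, ℍ)` (the image of `Π_ℍ` is all of `Π_𝒢`, so its relative index in anything
is `1 ≠ 0`). [cite: MochizukiSemiAnbd2006, Rem. 2.6.1 p.29] -/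
theorem remark261_not_prop26Conclusion_KH
    (F : (remark261Groups H).toAnabelioids.V (0 : Fin 3) ⥤ FintypeCat.{0})
    (F' : (remark261Groups H).toAnabelioids.V (1 : Fin 3) ⥤ FintypeCat.{0})
    (β : (remark261Groups H).toAnabelioids.ρ (0 : Fin 3) ⋙ F ≅
      (remark261Groups H).toAnabelioids.ρ (1 : Fin 3) ⋙ F') :
    ¬ Prop26Conclusion (remark261Groups H).toAnabelioids remark261K remark261H
        ⟨(1 : Fin 3), Or.inl rfl⟩ F' ⟨(0 : Fin 3), rfl⟩ F β := by
  intro h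
  obtain ⟨h1, -⟩ := h
  have hPB : ((Aut.autMulEquivOfIso β).toMonoidHom.comp
      ((remark261Groups H).toAnabelioids.piHToPi remark261H ⟨(0 : Fin 3), rfl⟩ F)).range = ⊤ := by
    rw [MonoidHom.range_eq_top]
    exact (Aut.autMulEquivOfIso β).surjective.comp
      (MonoidHom.range_eq_top.mp (remark261_range_piHToPi_H H F))
  have h2 := h1 1
  rw [map_one, one_smul, hPB, Subgroup.relIndex_top_left] at h2
  exact one_ne_zero h2

end Remark261

end Literature.AnabelianGeometry.SemiGraphs
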